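import Summits.AnomalousDissipation.AnomalousDissipation.Theorems.MomentParityQuarticGateCoords
import Summits.AnomalousDissipation.AnomalousDissipation.Theorems.MomentParityQuarticGateRows
import Summits.AnomalousDissipation.AnomalousDissipation.Theorems.MomentParityQuarticGateDefectPoly
import Summits.AnomalousDissipation.AnomalousDissipation.Theorems.MomentParityQuarticGateDefectCone

/-!
# Defect certificate for `MomentParity.QuarticGate` (stmt-AnomalousDissipation-11464),
# line `recession-cone`, stub S3 `stub_defectCertificate`

THE LEVER of the line (recession cone of the quartic moment cone). Assuming the sign lemma (S1) and
the absence of homogeneous cubic Casimirs at level `N`, every level-`N` law `μ` with finite fourth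
moments admits a DEFECT CERTIFICATE: finitely many level-`N` fields `vₗ` and weights `cₗ ≥ 0` with
`row_μ(p₃) + Σₗ cₗ {p₃, B_N}(vₗ) = 0` for every homogeneous cubic band test `p₃`.

Structure of the proof (finite-dimensional convex duality):

* `W :=` homogeneous cubic polynomials in the coordinates `(u, bᵢ)` of an orthonormal band basis
  `b` of `V_N` (`exists_bandBasis`, `…Theorems.MomentParityQuarticGateBasis`); every band datum
  `(m, g, P)` is transported to `W` with the same differential field
  (`band_eq_sum_smul`, `pairing_band_eq_sum` of `…Coords`, `polyGrad_transport` of `…Rows`).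
* The row `ψ(P) = ∫ ⟨F(u), ∇p(u)⟩ dμ` and the Euler derivatives `ev_v(P) = {p, B_N}(v)` are linear
  functionals on `W` (`exists_cubicRowFunctional`, `exists_eulerFunctional`; integrability from
  `∫ ‖u‖⁴ < ∞`, `integrable_nsGeneratorPairing_polyGrad`).
* If `ev_v(P) ≥ 0` for all level-`N` `v` then (sign lemma) `ev_v(P) = 0` for all `v`, then (no cubic
  Casimir) `P` vanishes on level-`N` fields, i.e. on all coordinate vectors
  (`exists_level_of_coords`), so `P = 0`. Hence the abstract cone lemma
  `exists_conic_certificate` (`…DefectCone`) applies: `-ψ` is a finite conic combination of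
  Euler derivatives (`exists_defectCertificate_coords`), which is the certificate.
-/

namespace Summit.AnomalousDissipation.AnomalousDissipation.Theorems.MomentParityQuarticGate

open MeasureTheory Filter
open scoped InnerProductSpace RealInnerProductSpace ENNReal
open Literature.Analysis.FunctionSpaces Literature.Analysis.FluidPDE
open Summit.AnomalousDissipation.AnomalousDissipation.Theses.MomentParity
open Summit.AnomalousDissipation.AnomalousDissipation.Theorems.QuarticGate.Negative
open MvPolynomial

set_option linter.dupNamespace false

variable {N n : ℕ} {b : Fin n → UnitAddTorus (Fin 3) → EuclideanSpace ℝ (Fin 3)}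

/-! ## The row integrand in coordinates -/

/-- **The tested generator against a differential field, in coordinates**:
`⟨F(u), ∇p(u)⟩ = Σᵢ ∂ᵢP((u,b)) ⟨F(u), bᵢ⟩`. [folklore] -/
theorem nsGeneratorPairing_polyGrad_eq_sum (hb : ∀ i, IsBandTest N (b i)) (ν : ℝ)
    {f : UnitAddTorus (Fin 3) → EuclideanSpace ℝ (Fin 3)} (hf : Integrable f volume)
    (P : MvPolynomial (Fin n) ℝ) (u : Torus.energySpace (Fin 3)) :
    Torus.nsGeneratorPairing ν f u (polyGrad b P u) =
      ∑ i, eval (fun j => Torus.pairing u.1 (b j)) (pderiv i P) *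
        Torus.nsGeneratorPairing ν f u (b i) :=
  Torus.nsGeneratorPairing_sum_smul ν hf u Finset.univ _ fun i _ => (hb i).1

/-- The row integrand is additive in `P`. [folklore] -/
theorem nsGeneratorPairing_polyGrad_add (hb : ∀ i, IsBandTest N (b i)) (ν : ℝ)
    {f : UnitAddTorus (Fin 3) → EuclideanSpace ℝ (Fin 3)} (hf : Integrable f volume)
    (P Q : MvPolynomial (Fin n) ℝ) (u : Torus.energySpace (Fin 3)) :
    Torus.nsGeneratorPairing ν f u (polyGrad b (P + Q) u) =
      Torus.nsGeneratorPairing ν f u (polyGrad b P u) + Torus.nsGeneratorPairing ν f u (polyGrad b Q u) := by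
  simp only [nsGeneratorPairing_polyGrad_eq_sum hb ν hf, map_add, add_mul, Finset.sum_add_distrib]

/-- The row integrand is homogeneous in `P`. [folklore] -/
theorem nsGeneratorPairing_polyGrad_smul (hb : ∀ i, IsBandTest N (b i)) (ν : ℝ)
    {f : UnitAddTorus (Fin 3) → EuclideanSpace ℝ (Fin 3)} (hf : Integrable f volume)
    (c : ℝ) (P : MvPolynomial (Fin n) ℝ) (u : Torus.energySpace (Fin 3)) :
    Torus.nsGeneratorPairing ν f u (polyGrad b (c • P) u) =
      c * Torus.nsGeneratorPairing ν f u (polyGrad b P u) := by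
  simp only [nsGeneratorPairing_polyGrad_eq_sum hb ν hf, Derivation.map_smul, smul_eval,
    Finset.mul_sum, mul_assoc]

/-! ## Integrability of cubic rows under a law with finite fourth moments -/

/-- **Growth control.** For a homogeneous quadratic `Q` and a band test `bᵢ` of an orthonormal band
family, `u ↦ Q((u,b)) ⟨F(u), bᵢ⟩` is integrable under every finite law on `H` with `∫ ‖u‖⁴ < ∞`
(`|Q((u,b))| ≤ C ‖u‖²`, `|⟨F(u), bᵢ⟩| ≤ K (1 + ‖u‖²)`). [folklore] -/
theorem integrable_eval_mul_nsGeneratorPairing (hb : ∀ i, IsBandTest N (b i))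
    (hbo : ∀ i j, ∫ x, ⟪b i x, b j x⟫_ℝ = if i = j then (1 : ℝ) else 0) (ν : ℝ)
    (f : UnitAddTorus (Fin 3) → EuclideanSpace ℝ (Fin 3)) {μ : Measure (Torus.energySpace (Fin 3))}
    [IsFiniteMeasure μ] (h4 : Integrable (fun u : Torus.energySpace (Fin 3) => ‖u‖ ^ 4) μ)
    {Q : MvPolynomial (Fin n) ℝ} (hQ : Q.IsHomogeneous 2) (i : Fin n) :
    Integrable (fun u : Torus.energySpace (Fin 3) =>
      eval (fun j => Torus.pairing u.1 (b j)) Q * Torus.nsGeneratorPairing ν f u (b i)) μ := by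
  obtain ⟨K, hK0, hK⟩ := Torus.exists_abs_nsGeneratorPairing_le ν f (hb i).1
  set C : ℝ := ∑ α ∈ Q.support, |coeff α Q| with hC
  have hC0 : 0 ≤ C := Finset.sum_nonneg fun α _ => abs_nonneg _
  have hcont : Continuous fun u : Torus.energySpace (Fin 3) =>
      eval (fun j => Torus.pairing u.1 (b j)) Q * Torus.nsGeneratorPairing ν f u (b i) :=
    ((continuous_eval Q).comp (continuous_coords hb)).mul
      (Torus.continuous_nsGeneratorPairing ν f (hb i).1)
  have hbound : ∀ u : Torus.energySpace (Fin 3),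
      ‖eval (fun j => Torus.pairing u.1 (b j)) Q * Torus.nsGeneratorPairing ν f u (b i)‖ ≤
        C * K * (1 + 2 * ‖u‖ ^ 4) := by
    intro u
    rw [Real.norm_eq_abs, abs_mul]
    have h1 : |eval (fun j => Torus.pairing u.1 (b j)) Q| ≤ C * ‖u‖ ^ 2 :=
      abs_eval_le_of_isHomogeneous hQ fun j => abs_coord_le_norm hb hbo u j
    have h2 := hK u
    have h3 : ‖u‖ ^ 2 * (1 + ‖u‖ ^ 2) ≤ 1 + 2 * ‖u‖ ^ 4 := by
      nlinarith [sq_nonneg (‖u‖ ^ 2 - 1), sq_nonneg ‖u‖]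
    calc |eval (fun j => Torus.pairing u.1 (b j)) Q| * |Torus.nsGeneratorPairing ν f u (b i)|
        ≤ (C * ‖u‖ ^ 2) * (K * (1 + ‖u‖ ^ 2)) :=
          mul_le_mul h1 h2 (abs_nonneg _) (mul_nonneg hC0 (sq_nonneg _))
      _ = C * K * (‖u‖ ^ 2 * (1 + ‖u‖ ^ 2)) := by ring
      _ ≤ C * K * (1 + 2 * ‖u‖ ^ 4) :=
          mul_le_mul_of_nonneg_left h3 (mul_nonneg hC0 hK0)
  have hdom : Integrable (fun u : Torus.energySpace (Fin 3) => C * K * (1 + 2 * ‖u‖ ^ 4)) μ :=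
    ((integrable_const (1 : ℝ)).add (h4.const_mul 2)).const_mul (C * K)
  exact hdom.mono' hcont.aestronglyMeasurable (ae_of_all _ hbound)

/-- **Cubic rows are integrable**: for `P` homogeneous of degree `3` the row integrand
`u ↦ ⟨F(u), ∇p(u)⟩` is integrable under every finite law on `H` with `∫ ‖u‖⁴ < ∞`. [folklore] -/
theorem integrable_nsGeneratorPairing_polyGrad (hb : ∀ i, IsBandTest N (b i))
    (hbo : ∀ i j, ∫ x, ⟪b i x, b j x⟫_ℝ = if i = j then (1 : ℝ) else 0) (ν : ℝ)
    {f : UnitAddTorus (Fin 3) → EuclideanSpace ℝ (Fin 3)} (hf : Integrable f volume)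
    {μ : Measure (Torus.energySpace (Fin 3))} [IsFiniteMeasure μ]
    (h4 : Integrable (fun u : Torus.energySpace (Fin 3) => ‖u‖ ^ 4) μ)
    {P : MvPolynomial (Fin n) ℝ} (hP : P.IsHomogeneous 3) :
    Integrable (fun u : Torus.energySpace (Fin 3) =>
      Torus.nsGeneratorPairing ν f u (polyGrad b P u)) μ := by
  simp_rw [nsGeneratorPairing_polyGrad_eq_sum hb ν hf]
  exact integrable_finsetSum _ fun i _ =>
    integrable_eval_mul_nsGeneratorPairing hb hbo ν f h4 hP.pderiv i

/-! ## The row and the Euler derivative as linear functionals on homogeneous cubics -/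

/-- **The cubic row functional.** `P ↦ ∫ ⟨F(u), ∇p(u)⟩ dμ` is a linear functional on the
homogeneous cubic polynomials in the coordinates (finite law, `∫ ‖u‖⁴ < ∞`). [folklore] -/
theorem exists_cubicRowFunctional (hb : ∀ i, IsBandTest N (b i))
    (hbo : ∀ i j, ∫ x, ⟪b i x, b j x⟫_ℝ = if i = j then (1 : ℝ) else 0) (ν : ℝ)
    {f : UnitAddTorus (Fin 3) → EuclideanSpace ℝ (Fin 3)} (hf : Integrable f volume)
    (μ : Measure (Torus.energySpace (Fin 3))) [IsFiniteMeasure μ]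
    (h4 : Integrable (fun u : Torus.energySpace (Fin 3) => ‖u‖ ^ 4) μ) :
    ∃ ψ : ↥(homogeneousSubmodule (Fin n) ℝ 3) →ₗ[ℝ] ℝ,
      ∀ P : ↥(homogeneousSubmodule (Fin n) ℝ 3),
        ψ P = ∫ u, Torus.nsGeneratorPairing ν f u (polyGrad b P.1 u) ∂μ := by
  refine ⟨{ toFun := fun P => ∫ u, Torus.nsGeneratorPairing ν f u (polyGrad b P.1 u) ∂μ
            map_add' := fun P Q => ?_
            map_smul' := fun c P => ?_ }, fun P => rfl⟩
  · simp only [Submodule.coe_add]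
    simp_rw [nsGeneratorPairing_polyGrad_add hb ν hf]
    exact integral_add (integrable_nsGeneratorPairing_polyGrad hb hbo ν hf h4 P.2)
      (integrable_nsGeneratorPairing_polyGrad hb hbo ν hf h4 Q.2)
  · simp only [Submodule.coe_smul, RingHom.id_apply, smul_eq_mul]
    simp_rw [nsGeneratorPairing_polyGrad_smul hb ν hf]
    exact integral_const_mul _ _

/-- **The Euler-derivative functionals.** For every `v ∈ H`, `P ↦ {p, B}(v) = ⟨B(v), ∇p(v)⟩`
(`ν = 0`, `f = 0`) is a linear functional on the homogeneous cubic polynomials in the coordinates.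
[folklore] -/
theorem exists_eulerFunctional (hb : ∀ i, IsBandTest N (b i)) :
    ∃ ev : Torus.energySpace (Fin 3) → ↥(homogeneousSubmodule (Fin n) ℝ 3) →ₗ[ℝ] ℝ,
      ∀ (v : Torus.energySpace (Fin 3)) (P : ↥(homogeneousSubmodule (Fin n) ℝ 3)),
        ev v P = Torus.nsGeneratorPairing (d := Fin 3) 0 0 v (polyGrad b P.1 v) := by
  refine ⟨fun v =>
    { toFun := fun P => Torus.nsGeneratorPairing (d := Fin 3) 0 0 v (polyGrad b P.1 v)
      map_add' := fun P Q => ?_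
      map_smul' := fun c P => ?_ }, fun v P => rfl⟩
  · simp only [Submodule.coe_add]
    exact nsGeneratorPairing_polyGrad_add hb 0 (integrable_zero _ _ _) P.1 Q.1 v
  · simp only [Submodule.coe_smul, RingHom.id_apply, smul_eq_mul]
    exact nsGeneratorPairing_polyGrad_smul hb 0 (integrable_zero _ _ _) c P.1 v

/-! ## The defect certificate in coordinates -/

/-- **The defect certificate in the coordinates of an orthonormal band basis.** Assume the sign
lemma and the absence of homogeneous cubic Casimirs at level `N` (both in the unfolded form of the
crux). Then for every viscosity, integrable force and finite law `μ` on `H` with `∫ ‖u‖⁴ dμ < ∞`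
there are finitely many level-`N` fields `vₗ` and weights `cₗ ≥ 0` with
`∫ ⟨F(u), ∇p(u)⟩ dμ + Σₗ cₗ {p, B_N}(vₗ) = 0` for every homogeneous cubic `P` in the coordinates
`(u, bᵢ)`. Proof: the abstract cone lemma `exists_conic_certificate` on the homogeneous cubics,
with `ev v` the Euler derivatives and `ψ` the row; a cubic whose Euler derivatives are all `≥ 0`
has vanishing Euler derivatives (sign lemma), hence vanishes on level-`N` fields (no cubic
Casimir), hence is the zero polynomial (every coordinate vector is realised). [folklore] -/
theorem exists_defectCertificate_coords
    (hS : ∀ (N m : ℕ) (g : Fin m → UnitAddTorus (Fin 3) → EuclideanSpace ℝ (Fin 3))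
      (P : MvPolynomial (Fin m) ℝ),
      (∀ i, (Torus.IsSmooth (g i) ∧ Torus.IsDivFree (g i) ∧ Torus.HasZeroMean (g i) ∧
        ∀ k ∉ (Torus.freqBall N).erase (0 : Fin 3 → ℤ),
          UnitAddTorus.mFourierCoeff (EuclideanSpace.complexify ∘ (g i)) k = 0)) →
      (∀ u : Torus.energySpace (Fin 3), (∀ k ∉ (Torus.freqBall N).erase (0 : Fin 3 → ℤ),
          UnitAddTorus.mFourierCoeff (EuclideanSpace.complexify ∘ (u.1 : UnitAddTorus (Fin 3) → EuclideanSpace ℝ (Fin 3))) k = 0) →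
        0 ≤ Torus.nsGeneratorPairing (d := Fin 3) 0 0 u
          (fun x => ∑ i, (MvPolynomial.eval (fun j => Torus.pairing u.1 (g j))
            (MvPolynomial.pderiv i P)) • g i x)) →
      ∀ u : Torus.energySpace (Fin 3), (∀ k ∉ (Torus.freqBall N).erase (0 : Fin 3 → ℤ),
          UnitAddTorus.mFourierCoeff (EuclideanSpace.complexify ∘ (u.1 : UnitAddTorus (Fin 3) → EuclideanSpace ℝ (Fin 3))) k = 0) →
        Torus.nsGeneratorPairing (d := Fin 3) 0 0 u
          (fun x => ∑ i, (MvPolynomial.eval (fun j => Torus.pairing u.1 (g j))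
            (MvPolynomial.pderiv i P)) • g i x) = 0)
    (hC : ∀ (m : ℕ) (g : Fin m → UnitAddTorus (Fin 3) → EuclideanSpace ℝ (Fin 3))
      (P : MvPolynomial (Fin m) ℝ),
      (∀ i, (Torus.IsSmooth (g i) ∧ Torus.IsDivFree (g i) ∧ Torus.HasZeroMean (g i) ∧
        ∀ k ∉ (Torus.freqBall N).erase (0 : Fin 3 → ℤ),
          UnitAddTorus.mFourierCoeff (EuclideanSpace.complexify ∘ (g i)) k = 0)) → P.IsHomogeneous 3 →
      (∀ u : Torus.energySpace (Fin 3), (∀ k ∉ (Torus.freqBall N).erase (0 : Fin 3 → ℤ),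
          UnitAddTorus.mFourierCoeff (EuclideanSpace.complexify ∘ (u.1 : UnitAddTorus (Fin 3) → EuclideanSpace ℝ (Fin 3))) k = 0) →
        Torus.nsGeneratorPairing (d := Fin 3) 0 0 u
          (fun x => ∑ i, (MvPolynomial.eval (fun j => Torus.pairing u.1 (g j))
            (MvPolynomial.pderiv i P)) • g i x) = 0) →
      ∀ u : Torus.energySpace (Fin 3), (∀ k ∉ (Torus.freqBall N).erase (0 : Fin 3 → ℤ),
          UnitAddTorus.mFourierCoeff (EuclideanSpace.complexify ∘ (u.1 : UnitAddTorus (Fin 3) → EuclideanSpace ℝ (Fin 3))) k = 0) →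
        MvPolynomial.eval (fun j => Torus.pairing u.1 (g j)) P = 0)
    (ν : ℝ) {f : UnitAddTorus (Fin 3) → EuclideanSpace ℝ (Fin 3)} (hf : Integrable f volume)
    (μ : Measure (Torus.energySpace (Fin 3))) [IsFiniteMeasure μ]
    (h4 : Integrable (fun u : Torus.energySpace (Fin 3) => ‖u‖ ^ 4) μ)
    (hb : ∀ i, IsBandTest N (b i))
    (hbo : ∀ i j, ∫ x, ⟪b i x, b j x⟫_ℝ = if i = j then (1 : ℝ) else 0) :
    ∃ (M : ℕ) (v : Fin M → Torus.energySpace (Fin 3)) (c : Fin M → ℝ),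
      (∀ l, IsLevel N (v l)) ∧ (∀ l, 0 ≤ c l) ∧
      ∀ P : MvPolynomial (Fin n) ℝ, P.IsHomogeneous 3 →
        ∫ u, Torus.nsGeneratorPairing ν f u (polyGrad b P u) ∂μ +
          ∑ l, c l * Torus.nsGeneratorPairing (d := Fin 3) 0 0 (v l) (polyGrad b P (v l)) = 0 := by
  classical
  haveI : FiniteDimensional ℝ ↥(homogeneousSubmodule (Fin n) ℝ 3) :=
    Module.Finite.iff_fg.mpr (homogeneousSubmodule_fg (Fin n) ℝ 3)
  obtain ⟨ψ, hψ⟩ := exists_cubicRowFunctional hb hbo ν hf μ h4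
  obtain ⟨ev, hev⟩ := exists_eulerFunctional (n := n) hb
  -- the hypothesis of the cone lemma: the nonnegativity cone of the Euler derivatives is trivial
  have key : ∀ P : ↥(homogeneousSubmodule (Fin n) ℝ 3),
      (∀ x : {v : Torus.energySpace (Fin 3) // IsLevel N v}, 0 ≤ ev x.1 P) →
      ψ P = 0 ∧ ∀ x : {v : Torus.energySpace (Fin 3) // IsLevel N v}, ev x.1 P = 0 := by
    intro P hP
    have hPh : P.1.IsHomogeneous 3 := P.2
    have h0 : ∀ u : Torus.energySpace (Fin 3), IsLevel N u →
        Torus.nsGeneratorPairing (d := Fin 3) 0 0 u (polyGrad b P.1 u) = 0 :=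
      hS N n b P.1 hb fun u hu => by
        have h := hP ⟨u, hu⟩
        rw [hev] at h
        exact h
    refine ⟨?_, fun x => by rw [hev]; exact h0 x.1 x.2⟩
    have hvan : ∀ u : Torus.energySpace (Fin 3), IsLevel N u →
        eval (fun j => Torus.pairing u.1 (b j)) P.1 = 0 := hC n b P.1 hb hPh h0
    have hP0 : P.1 = 0 := by
      refine MvPolynomial.funext fun x => ?_
      obtain ⟨u, hul, huc, -, -⟩ := exists_level_of_coords hb hbo x
      rw [map_zero, ← hvan u hul, huc]
    have hP0' : P = 0 := Subtype.ext hP0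
    rw [hP0', map_zero]
  obtain ⟨M, x, c, hc0, hcert⟩ := exists_conic_certificate
    (fun x : {v : Torus.energySpace (Fin 3) // IsLevel N v} => ev x.1) ψ key
  refine ⟨M, fun l => (x l).1, c, fun l => (x l).2, hc0, fun P hP => ?_⟩
  have h := hcert ⟨P, hP⟩
  rw [hψ] at h
  simp_rw [hev] at h
  exact h


/-- **S3 — DEFECT CERTIFICATE** (the lever of the line `recession-cone`: the recession cone of the
quartic moment cone). Assume the sign lemma (S1, as a hypothesis: a polynomial cylindrical
observable whose Euler derivative `{p,B_N}` is `≥ 0` on level-`N` fields has `{p,B_N} ≡ 0` there) and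
that level `N` has no homogeneous cubic Casimir. Then for every viscosity `ν`, smooth force `f` and
level-`N` probability law `μ` with `∫ ‖u‖⁴ dμ < ∞` there are finitely many level-`N` fields `vₗ` and
weights `cₗ ≥ 0` with `∫ ⟨F(u), ∇p(u)⟩ dμ + Σₗ cₗ {p,B_N}(vₗ) = 0` for EVERY band test datum
`(m, g, P)` with `P` homogeneous cubic.
Proof: expand the band tests in an orthonormal band basis `b` of `V_N` (`exists_bandBasis`,
`band_eq_sum_smul`, `pairing_band_eq_sum`), which transports `(g, P)` to `(b, P ∘ G)` with the same
differential field (`polyGrad_transport`) and keeps homogeneity; in these coordinates the statement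
is `exists_defectCertificate_coords` (finite-dimensional convex duality `exists_conic_certificate`:
the cone generated by the Euler-derivative functionals has trivial dual by the two hypotheses, so it
contains minus the row functional). -/
theorem stub_defectCertificate :
    (∀ (N m : ℕ) (g : Fin m → UnitAddTorus (Fin 3) → EuclideanSpace ℝ (Fin 3))
      (P : MvPolynomial (Fin m) ℝ),
      (∀ i, (Torus.IsSmooth (g i) ∧ Torus.IsDivFree (g i) ∧ Torus.HasZeroMean (g i) ∧
        ∀ k ∉ (Torus.freqBall N).erase (0 : Fin 3 → ℤ),
          UnitAddTorus.mFourierCoeff (EuclideanSpace.complexify ∘ (g i)) k = 0)) →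
      (∀ u : Torus.energySpace (Fin 3), (∀ k ∉ (Torus.freqBall N).erase (0 : Fin 3 → ℤ),
          UnitAddTorus.mFourierCoeff (EuclideanSpace.complexify ∘ (u.1 : UnitAddTorus (Fin 3) → EuclideanSpace ℝ (Fin 3))) k = 0) →
        0 ≤ Torus.nsGeneratorPairing (d := Fin 3) 0 0 u
          (fun x => ∑ i, (MvPolynomial.eval (fun j => Torus.pairing u.1 (g j))
            (MvPolynomial.pderiv i P)) • g i x)) →
      ∀ u : Torus.energySpace (Fin 3), (∀ k ∉ (Torus.freqBall N).erase (0 : Fin 3 → ℤ),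
          UnitAddTorus.mFourierCoeff (EuclideanSpace.complexify ∘ (u.1 : UnitAddTorus (Fin 3) → EuclideanSpace ℝ (Fin 3))) k = 0) →
        Torus.nsGeneratorPairing (d := Fin 3) 0 0 u
          (fun x => ∑ i, (MvPolynomial.eval (fun j => Torus.pairing u.1 (g j))
            (MvPolynomial.pderiv i P)) • g i x) = 0) →
    ∀ N : ℕ, (∀ (m : ℕ) (g : Fin m → UnitAddTorus (Fin 3) → EuclideanSpace ℝ (Fin 3))
      (P : MvPolynomial (Fin m) ℝ),
      (∀ i, (Torus.IsSmooth (g i) ∧ Torus.IsDivFree (g i) ∧ Torus.HasZeroMean (g i) ∧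
        ∀ k ∉ (Torus.freqBall N).erase (0 : Fin 3 → ℤ),
          UnitAddTorus.mFourierCoeff (EuclideanSpace.complexify ∘ (g i)) k = 0)) → P.IsHomogeneous 3 →
      (∀ u : Torus.energySpace (Fin 3), (∀ k ∉ (Torus.freqBall N).erase (0 : Fin 3 → ℤ),
          UnitAddTorus.mFourierCoeff (EuclideanSpace.complexify ∘ (u.1 : UnitAddTorus (Fin 3) → EuclideanSpace ℝ (Fin 3))) k = 0) →
        Torus.nsGeneratorPairing (d := Fin 3) 0 0 u
          (fun x => ∑ i, (MvPolynomial.eval (fun j => Torus.pairing u.1 (g j))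
            (MvPolynomial.pderiv i P)) • g i x) = 0) →
      ∀ u : Torus.energySpace (Fin 3), (∀ k ∉ (Torus.freqBall N).erase (0 : Fin 3 → ℤ),
          UnitAddTorus.mFourierCoeff (EuclideanSpace.complexify ∘ (u.1 : UnitAddTorus (Fin 3) → EuclideanSpace ℝ (Fin 3))) k = 0) →
        MvPolynomial.eval (fun j => Torus.pairing u.1 (g j)) P = 0) →
    ∀ (ν : ℝ) (f : UnitAddTorus (Fin 3) → EuclideanSpace ℝ (Fin 3)), Torus.IsSmooth f →
    ∀ μ : Measure (Torus.energySpace (Fin 3)), IsProbabilityMeasure μ →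
      (∀ᵐ u ∂μ, (∀ k ∉ (Torus.freqBall N).erase (0 : Fin 3 → ℤ),
          UnitAddTorus.mFourierCoeff (EuclideanSpace.complexify ∘ (u.1 : UnitAddTorus (Fin 3) → EuclideanSpace ℝ (Fin 3))) k = 0)) → Integrable (fun u : Torus.energySpace (Fin 3) => ‖u‖ ^ 4) μ →
      ∃ (M : ℕ) (v : Fin M → Torus.energySpace (Fin 3)) (c : Fin M → ℝ),
      ((∀ l, (∀ k ∉ (Torus.freqBall N).erase (0 : Fin 3 → ℤ),
          UnitAddTorus.mFourierCoeff (EuclideanSpace.complexify ∘ ((v l).1 : UnitAddTorus (Fin 3) → EuclideanSpace ℝ (Fin 3))) k = 0)) ∧ (∀ l, 0 ≤ c l) ∧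
      ∀ (m : ℕ) (g : Fin m → UnitAddTorus (Fin 3) → EuclideanSpace ℝ (Fin 3))
      (P : MvPolynomial (Fin m) ℝ),
      (∀ i, (Torus.IsSmooth (g i) ∧ Torus.IsDivFree (g i) ∧ Torus.HasZeroMean (g i) ∧
        ∀ k ∉ (Torus.freqBall N).erase (0 : Fin 3 → ℤ),
          UnitAddTorus.mFourierCoeff (EuclideanSpace.complexify ∘ (g i)) k = 0)) → P.IsHomogeneous 3 →
      ∫ u, Torus.nsGeneratorPairing ν f u
          (fun x => ∑ i, (MvPolynomial.eval (fun j => Torus.pairing u.1 (g j))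
            (MvPolynomial.pderiv i P)) • g i x) ∂μ +
        ∑ l, c l * Torus.nsGeneratorPairing (d := Fin 3) 0 0 (v l)
          (fun x => ∑ i, (MvPolynomial.eval (fun j => Torus.pairing (v l).1 (g j))
            (MvPolynomial.pderiv i P)) • g i x) = 0) := by
  intro hS N hC ν f hf μ hμ _hμl h4
  obtain ⟨n, b, hb, hbo, hbs⟩ := exists_bandBasis N
  obtain ⟨M, v, c, hvl, hc0, hcert⟩ :=
    exists_defectCertificate_coords hS hC ν hf.integrable μ h4 hb hbo
  refine ⟨M, v, c, hvl, hc0, fun m g P hg hP => ?_⟩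
  -- transport the datum `(g, P)` to the coordinates of `b`
  have hgb : ∀ (j : Fin m) (x : UnitAddTorus (Fin 3)),
      g j x = ∑ i, (∫ y, ⟪g j y, b i y⟫_ℝ) • b i x := fun j x => band_eq_sum_smul hbs (hg j) x
  have hpair : ∀ (u : Torus.energySpace (Fin 3)) (j : Fin m),
      Torus.pairing u.1 (g j) = ∑ i, (∫ y, ⟪g j y, b i y⟫_ℝ) * Torus.pairing u.1 (b i) :=
    fun u j => pairing_band_eq_sum hb hbs (hg j) u
  have ht : ∀ u : Torus.energySpace (Fin 3), polyGrad g P u =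
      polyGrad b (MvPolynomial.bind₁ (fun j => ∑ i, MvPolynomial.C (∫ y, ⟪g j y, b i y⟫_ℝ) *
        (MvPolynomial.X i : MvPolynomial (Fin n) ℝ)) P) u :=
    fun u => funext (polyGrad_transport (fun j i => ∫ y, ⟪g j y, b i y⟫_ℝ) hgb hpair P u)
  have h := hcert _ (isHomogeneous_bind₁_linear (fun j i => ∫ y, ⟪g j y, b i y⟫_ℝ) hP)
  show ∫ u, Torus.nsGeneratorPairing ν f u (polyGrad g P u) ∂μ +
      ∑ l, c l * Torus.nsGeneratorPairing (d := Fin 3) 0 0 (v l) (polyGrad g P (v l)) = 0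
  simp_rw [ht]
  exact h

/-- **S3 — defect certificate, `:=`-free spelling.** The statement of `stub_defectCertificate` with
the implicit dimension of `Torus.nsGeneratorPairing` pinned by a type ascription on the zero force
instead of the named argument `(d := Fin 3)` (the two statements elaborate to the same proposition;
this spelling is the one registered on the crux item, whose registry cannot store `:=`). [folklore] -/
theorem recessionCone_defectCertificate :
    (∀ (N m : ℕ) (g : Fin m → UnitAddTorus (Fin 3) → EuclideanSpace ℝ (Fin 3))
      (P : MvPolynomial (Fin m) ℝ),
      (∀ i, (Torus.IsSmooth (g i) ∧ Torus.IsDivFree (g i) ∧ Torus.HasZeroMean (g i) ∧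
        ∀ k ∉ (Torus.freqBall N).erase (0 : Fin 3 → ℤ),
          UnitAddTorus.mFourierCoeff (EuclideanSpace.complexify ∘ (g i)) k = 0)) →
      (∀ u : Torus.energySpace (Fin 3), (∀ k ∉ (Torus.freqBall N).erase (0 : Fin 3 → ℤ),
          UnitAddTorus.mFourierCoeff (EuclideanSpace.complexify ∘ (u.1 : UnitAddTorus (Fin 3) → EuclideanSpace ℝ (Fin 3))) k = 0) →
        0 ≤ Torus.nsGeneratorPairing 0 (0 : UnitAddTorus (Fin 3) → EuclideanSpace ℝ (Fin 3)) u
          (fun x => ∑ i, (MvPolynomial.eval (fun j => Torus.pairing u.1 (g j))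
            (MvPolynomial.pderiv i P)) • g i x)) →
      ∀ u : Torus.energySpace (Fin 3), (∀ k ∉ (Torus.freqBall N).erase (0 : Fin 3 → ℤ),
          UnitAddTorus.mFourierCoeff (EuclideanSpace.complexify ∘ (u.1 : UnitAddTorus (Fin 3) → EuclideanSpace ℝ (Fin 3))) k = 0) →
        Torus.nsGeneratorPairing 0 (0 : UnitAddTorus (Fin 3) → EuclideanSpace ℝ (Fin 3)) u
          (fun x => ∑ i, (MvPolynomial.eval (fun j => Torus.pairing u.1 (g j))
            (MvPolynomial.pderiv i P)) • g i x) = 0) →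
    ∀ N : ℕ, (∀ (m : ℕ) (g : Fin m → UnitAddTorus (Fin 3) → EuclideanSpace ℝ (Fin 3))
      (P : MvPolynomial (Fin m) ℝ),
      (∀ i, (Torus.IsSmooth (g i) ∧ Torus.IsDivFree (g i) ∧ Torus.HasZeroMean (g i) ∧
        ∀ k ∉ (Torus.freqBall N).erase (0 : Fin 3 → ℤ),
          UnitAddTorus.mFourierCoeff (EuclideanSpace.complexify ∘ (g i)) k = 0)) → P.IsHomogeneous 3 →
      (∀ u : Torus.energySpace (Fin 3), (∀ k ∉ (Torus.freqBall N).erase (0 : Fin 3 → ℤ),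
          UnitAddTorus.mFourierCoeff (EuclideanSpace.complexify ∘ (u.1 : UnitAddTorus (Fin 3) → EuclideanSpace ℝ (Fin 3))) k = 0) →
        Torus.nsGeneratorPairing 0 (0 : UnitAddTorus (Fin 3) → EuclideanSpace ℝ (Fin 3)) u
          (fun x => ∑ i, (MvPolynomial.eval (fun j => Torus.pairing u.1 (g j))
            (MvPolynomial.pderiv i P)) • g i x) = 0) →
      ∀ u : Torus.energySpace (Fin 3), (∀ k ∉ (Torus.freqBall N).erase (0 : Fin 3 → ℤ),
          UnitAddTorus.mFourierCoeff (EuclideanSpace.complexify ∘ (u.1 : UnitAddTorus (Fin 3) → EuclideanSpace ℝ (Fin 3))) k = 0) →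
        MvPolynomial.eval (fun j => Torus.pairing u.1 (g j)) P = 0) →
    ∀ (ν : ℝ) (f : UnitAddTorus (Fin 3) → EuclideanSpace ℝ (Fin 3)), Torus.IsSmooth f →
    ∀ μ : Measure (Torus.energySpace (Fin 3)), IsProbabilityMeasure μ →
      (∀ᵐ u ∂μ, (∀ k ∉ (Torus.freqBall N).erase (0 : Fin 3 → ℤ),
          UnitAddTorus.mFourierCoeff (EuclideanSpace.complexify ∘ (u.1 : UnitAddTorus (Fin 3) → EuclideanSpace ℝ (Fin 3))) k = 0)) → Integrable (fun u : Torus.energySpace (Fin 3) => ‖u‖ ^ 4) μ →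
      ∃ (M : ℕ) (v : Fin M → Torus.energySpace (Fin 3)) (c : Fin M → ℝ),
      ((∀ l, (∀ k ∉ (Torus.freqBall N).erase (0 : Fin 3 → ℤ),
          UnitAddTorus.mFourierCoeff (EuclideanSpace.complexify ∘ ((v l).1 : UnitAddTorus (Fin 3) → EuclideanSpace ℝ (Fin 3))) k = 0)) ∧ (∀ l, 0 ≤ c l) ∧
      ∀ (m : ℕ) (g : Fin m → UnitAddTorus (Fin 3) → EuclideanSpace ℝ (Fin 3))
      (P : MvPolynomial (Fin m) ℝ),
      (∀ i, (Torus.IsSmooth (g i) ∧ Torus.IsDivFree (g i) ∧ Torus.HasZeroMean (g i) ∧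
        ∀ k ∉ (Torus.freqBall N).erase (0 : Fin 3 → ℤ),
          UnitAddTorus.mFourierCoeff (EuclideanSpace.complexify ∘ (g i)) k = 0)) → P.IsHomogeneous 3 →
      ∫ u, Torus.nsGeneratorPairing ν f u
          (fun x => ∑ i, (MvPolynomial.eval (fun j => Torus.pairing u.1 (g j))
            (MvPolynomial.pderiv i P)) • g i x) ∂μ +
        ∑ l, c l * Torus.nsGeneratorPairing 0 (0 : UnitAddTorus (Fin 3) → EuclideanSpace ℝ (Fin 3)) (v l)
          (fun x => ∑ i, (MvPolynomial.eval (fun j => Torus.pairing (v l).1 (g j))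
            (MvPolynomial.pderiv i P)) • g i x) = 0) :=
  stub_defectCertificate

end Summit.AnomalousDissipation.AnomalousDissipation.Theorems.MomentParityQuarticGate
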